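import Literature.ModelTheory.ExponentialFields.Wilkie1989Lemma3Proofs
import Literature.ModelTheory.ExponentialFields.Wilkie1989Khovanskii
import Literature.ModelTheory.ExponentialFields.RealExpFieldProofs
import Literature.ModelTheory.ExponentialFields.ModelTheoryPredsProofs
import Mathlib.Algebra.MvPolynomial.PDeriv
import Mathlib.RingTheory.MvPolynomial.Basic
import HarnessLib

/-!
# Wilkie 1989, §6: the case of height `0` (polynomial systems) of the induction `P_{j,s}`

Trunk `TranscendEllArithS`, family `periods` (periods.S28): towards the leaf
`Literature.ModelTheory.ExponentialFields.Wilkie1989_expAlgebraicPoints_mem` (`Wilkie1989.lean`;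
§§5–6 of A. J. Wilkie, *On the theory of the real exponential field*, Illinois J. Math. 33
(1989), 384–408) of the decomposition of the named fact
`Literature.ModelTheory.ExponentialFields.wilkie_isModelComplete`.

The proof of Theorem 2 (§6, p. 403) is an induction on `(j, s) ∈ ℕ²`: "`P_{j,s}`: Suppose `n ≥ 1`,
`M ⊆ k[x̄]ᵉ` has height `≤ j` … If `ᾱ ∈ Vⁿˢ(g₁, …, gₙ)` then `ᾱ ∈ kⁿ`.  For all `s ∈ ℕ`, `P_{0,s}` is
clear since it is well known that the coordinates of an `ᾱ ∈ Vⁿˢ(g₁, …, gₙ)`, where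
`g₁, …, gₙ ∈ k[x̄]`, are algebraic over `k`, and `k, K` are real-closed fields (being models of
`T_e`)."  This file **proves `P_{0,s}`** — for models `k ⊆ K` of `T_exp` and a square system of
polynomials over `k`, a non-singular zero in `Kⁿ` lies in `kⁿ` — under the hypothesis that the
non-singular zero set in `Kⁿ` is finite (which in §6 is supplied, uniformly, by Khovanskii's
theorem, `Wilkie1989Khovanskii.lean`; for polynomial systems it is classical).  The "well known"
argument is made through Tarski's theorem, which the tree proves (`tarski_hasQE_holds`,
`RealExpFieldProofs.lean`/`TarskiQE.lean`): the ordered-field reducts of `k ⊆ K` are models of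
`RCF` (`RealExpModel.model_RCF`, by transfer from `ℝ`), `RCF` is model complete
(`HasQE.isModelComplete_holds`), so `k ≼ K` for formulas of ordered rings; "the non-singular zero
set of `ḡ` has exactly `r` elements" is such a formula (with the coefficients as parameters), so
`kⁿ` and `Kⁿ` contain the same finite number of non-singular zeros and the embedding, being
injective, maps the former onto the latter (`RealExpModel.setOf_realize_eq_image_of_finite`,
`RealExpModel.exists_eq_of_nonsingular_mvPolynomial`).

For the induction of §6 as set up in the tree (`Wilkie1989Lemma3Proofs.lean`: the chain
`k = M₀ ⊆ k[x₁] ⊆ ⋯ ⊆ k[x̄] = Mₙ ⊆ Mₙ[e^{gₙ}] ⊆ ⋯` of subrings of the ring `k[x̄]ᵉ` of term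
functions, `RealExpModel.chain`), the stages `M_m`, `m ≤ n`, consist of polynomial functions: the
ring homomorphism `RealExpModel.polyFn : k[X₁, …, Xₙ] → k[x̄]ᵉ` has them in its range
(`RealExpModel.chain_le_range_polyFn`), and Wilkie's derivations `∂/∂xₗ` are the polynomial partial
derivatives on it (`RealExpModel.pd_polyFn`).  Hence **the height-`0` case in chain form**
(`RealExpModel.exists_eq_of_vnsF_chain_le`): if `h₁, …, hₙ ∈ M_m` (`m ≤ n`) and `ᾱ ∈ Vⁿˢ(h̄)` with
`Vⁿˢ(h̄) ⊆ Kⁿ` finite, then `ᾱ ∈ kⁿ`.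

Also here, for reuse: first-order counting formulas "at most / exactly `N` solutions" in an
arbitrary language (`FOCount.atMostF`, `FOCount.exactCardF`; the tree's `RealExpModel.atMostF` is
the special case of `Language.orderedExpRing`) and the model completeness of a theory applied to
formulas with an arbitrary type of free variables (`Theory.IsModelComplete.realize_comp_iff`).

## References

* A. J. Wilkie, *On the theory of the real exponential field*, Illinois J. Math. 33 (1989),
  384–408: §6, p. 403 (`P_{0,s}`).
* D. Marker, *Model Theory: An Introduction*, GTM 217 (2002), §3.3 (Tarski: `RCF` has quantifier
  elimination and is model complete, Cor. 3.3.16).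
-/

noncomputable section

open FirstOrder FirstOrder.Language FirstOrder.Language.Structure

namespace Literature.ModelTheory.ExponentialFields

/-! ### Counting solutions in first-order logic (any language) -/

namespace FOCount

variable {L : Language} {α : Type} {n : ℕ}

/-- **"There are at most `N` tuples `x̄` with `φ(v̄, x̄)`"** as a first-order formula in the
variables `v̄`: there are no `N + 1` pairwise distinct solutions. [folklore] -/
def atMostF (φ : L.Formula (α ⊕ Fin n)) (N : ℕ) : L.Formula α :=
  (Formula.iExs (Fin (N + 1) × Fin n)
      ((Formula.iInf fun i : Fin (N + 1) => φ.relabel (Sum.map _root_.id fun l => (i, l))) ⊓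
        Formula.iInf fun ij : {ij : Fin (N + 1) × Fin (N + 1) // ij.1 ≠ ij.2} =>
          Formula.iSup fun l : Fin n =>
            ((var (Sum.inr (ij.1.1, l))).equal (var (Sum.inr (ij.1.2, l)))).not)).not

/-- **"There are exactly `r` tuples `x̄` with `φ(v̄, x̄)`"**. [folklore] -/
def exactCardF (φ : L.Formula (α ⊕ Fin n)) : ℕ → L.Formula α
  | 0 => atMostF φ 0
  | r + 1 => atMostF φ (r + 1) ⊓ (atMostF φ r).not

variable {M : Type*} [L.Structure M]

/-- Realization of `atMostF`: the solution set has at most `N` elements. [folklore] -/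
theorem realize_atMostF (φ : L.Formula (α ⊕ Fin n)) (N : ℕ) (v : α → M) :
    (atMostF φ N).Realize v ↔ {x : Fin n → M | φ.Realize (Sum.elim v x)}.encard ≤ N := by
  rw [RealExpModel.encard_le_coe_iff_forall_not_injective]
  simp only [atMostF, Formula.realize_not, Formula.realize_iExs, Formula.realize_inf,
    Formula.realize_iInf, Formula.realize_iSup, Formula.realize_relabel, Formula.realize_equal,
    Term.realize_var, Sum.elim_inr, not_exists, not_and, Sum.elim_comp_map, Function.comp_id,
    Set.mem_setOf_eq]
  constructor
  · intro h f hf hinj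
    refine h (fun il => f il.1 il.2) (fun i => hf i) ?_
    rintro ⟨⟨i, j⟩, hij⟩
    by_contra hall
    push Not at hall
    exact hij (hinj (funext hall))
  · intro h w hw hdist
    refine h (fun i l => w (i, l)) (fun i => hw i) fun i j hij => ?_
    by_contra hne
    obtain ⟨l, hl⟩ := hdist ⟨(i, j), hne⟩
    exact hl (congrFun hij l)

/-- Realization of `exactCardF`: the solution set has exactly `r` elements. [folklore] -/
theorem realize_exactCardF (φ : L.Formula (α ⊕ Fin n)) (r : ℕ) (v : α → M) :
    (exactCardF φ r).Realize v ↔ {x : Fin n → M | φ.Realize (Sum.elim v x)}.encard = r := by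
  cases r with
  | zero =>
    rw [exactCardF, realize_atMostF]
    simp
  | succ r =>
    rw [exactCardF, Formula.realize_inf, Formula.realize_not, realize_atMostF, realize_atMostF,
      not_le]
    constructor
    · rintro ⟨h1, h2⟩
      refine le_antisymm h1 ?_
      rw [Nat.cast_add_one]
      exact Order.add_one_le_of_lt h2
    · intro h
      rw [h]
      exact ⟨le_rfl, by exact_mod_cast Nat.lt_succ_self r⟩

end FOCount

/-! ### Model completeness for formulas with arbitrary free variables -/

universe u v w in
/-- **Model completeness for formulas in any set of free variables**: if `T` is model complete then
embeddings of models of `T` preserve and reflect every formula, whatever the (possibly infinite)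
type of its free variables (restrict to the finitely many occurring ones). [folklore] -/
theorem _root_.FirstOrder.Language.Theory.IsModelComplete.realize_comp_iff {L : FirstOrder.Language.{u, v}}
    {T : L.Theory} (h : T.IsModelComplete) (M N : Language.Theory.ModelType.{u, v, max u v} T)
    (f : M ↪[L] N) {κ : Type w} (φ : L.Formula κ) (x : κ → M) :
    φ.Realize (f ∘ x) ↔ φ.Realize x := by
  classical
  -- restrict to the finite set of variables and number them
  set s := φ.freeVarFinset with hs
  obtain ⟨e⟩ : Nonempty (↥s ≃ Fin s.card) := ⟨Fintype.equivFinOfCardEq (by simp)⟩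
  set ψ : L.Formula (Fin s.card) := φ.restrictFreeVar (fun a => e a) with hψ
  have hM : φ.Realize x ↔ ψ.Realize (x ∘ (↑) ∘ e.symm) := by
    symm
    simpa [Formula.Realize, hψ] using
      (BoundedFormula.realize_restrictFreeVar (φ := φ) (f := fun a => e a)
        (v := x ∘ (↑) ∘ e.symm) (xs := default) x (fun a => by simp))
  have hN : φ.Realize (f ∘ x) ↔ ψ.Realize ((f ∘ x) ∘ (↑) ∘ e.symm) := by
    symm
    simpa [Formula.Realize, hψ] using
      (BoundedFormula.realize_restrictFreeVar (φ := φ) (f := fun a => e a)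
        (v := (f ∘ x) ∘ (↑) ∘ e.symm) (xs := default) (f ∘ x) (fun a => by simp))
  rw [hN, hM]
  exact h M N f _ ψ _

/-! ### Models of `T_exp` as real closed fields; embeddings of models as ordered-ring embeddings -/

namespace RealExpModel

variable (K : Language.Theory.ModelType.{0, 0, 0} realExpTheory)

/-- **Models of `T_exp` are real closed fields** (Wilkie 1989, p. 403: "`k, K` are real-closed
fields (being models of `T_e`)"): the ordered-field reduct of a model of `T_exp = Th(ℝ_exp)`
satisfies `RCF`, each axiom being a sentence of ordered rings true in `ℝ` and transferred.
[cite: Wilkie1989, §6, p. 403] -/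
instance model_RCF : (K : Type) ⊨ Theory.RCF := by
  refine ⟨fun σ hσ => ?_⟩
  have hR : (ℝ : Type) ⊨ σ := real_model_RCF.realize_of_mem σ hσ
  have h1 : ℝ ⊨ orderedRingHomOrderedExpRing.onSentence σ :=
    (LHom.realize_onSentence (M := ℝ) orderedRingHomOrderedExpRing σ).2 hR
  have h2 : (K : Type) ⊨ orderedRingHomOrderedExpRing.onSentence σ := realize_sentence_of_real K h1
  exact (LHom.realize_onSentence (M := (K : Type)) orderedRingHomOrderedExpRing σ).1 h2

/-- A model of `T_exp` bundled as a model of `RCF` (same carrier, ordered-ring reduct). [folklore] -/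
abbrev rcfModel : Language.Theory.ModelType.{0, 0, 0} Theory.RCF :=
  Language.Theory.ModelType.mk (K : Type)

variable {K} {k : Language.Theory.ModelType.{0, 0, 0} realExpTheory}

/-- **An embedding of models of `T_exp` is an embedding of their ordered-field reducts.**
[folklore] -/
def orEmbedding (f : k ↪[Language.orderedExpRing] K) :
    rcfModel k ↪[Language.orderedRing] rcfModel K where
  toFun := f
  inj' := f.injective
  map_fun' := by
    intro m F x
    have hx : ∀ i, (x i : k) = x i := fun i => rfl
    cases F
    · show f ((x 0 : k) + (x 1 : k)) = (f (x 0) : K) + (f (x 1) : K)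
      exact map_add f _ _
    · show f ((x 0 : k) * (x 1 : k)) = (f (x 0) : K) * (f (x 1) : K)
      exact map_mul f _ _
    · show f (-(x 0 : k)) = -(f (x 0) : K)
      exact map_neg f _
    · show f (0 : k) = (0 : K)
      exact map_zero f
    · show f (1 : k) = (1 : K)
      exact map_one f
  map_rel' := by
    intro m R x
    cases R
    show (f (x 0) : K) ≤ (f (x 1) : K) ↔ (x 0 : k) ≤ (x 1 : k)
    exact map_le_iff f _ _

/-- `orEmbedding f` is `f` as a map. [folklore] -/
@[simp] theorem coe_orEmbedding (f : k ↪[Language.orderedExpRing] K) :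
    ((orEmbedding f : rcfModel k ↪[Language.orderedRing] rcfModel K) : k → K) = f := rfl

/-- **`k ≼ K` for formulas of ordered rings** (Tarski; Wilkie 1989, p. 403, "well known"): an
embedding of models of `T_exp` preserves and reflects every formula of the language of ordered
rings, with parameters. [cite: Wilkie1989, §6, p. 403] -/
theorem realize_orderedRing_comp_iff (f : k ↪[Language.orderedExpRing] K) {κ : Type}
    (φ : Language.orderedRing.Formula κ) (v : κ → k) :
    φ.Realize ((f : k → K) ∘ v) ↔ φ.Realize v := by
  have hmc : Theory.RCF.IsModelComplete :=
    Language.Theory.HasQE.isModelComplete_holds tarski_hasQE_holds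
  exact Language.Theory.IsModelComplete.realize_comp_iff hmc (rcfModel k) (rcfModel K)
    (orEmbedding f) φ v

/-- **Finite definable sets over `k` have all their `K`-points in `kⁿ`.**  If a formula of ordered
rings with parameters `c̄` from `k` has only finitely many solutions in `Kⁿ`, then these are
exactly the images of its solutions in `kⁿ` (count the solutions with `FOCount.exactCardF` and use
`k ≼ K`). [cite: Wilkie1989, §6, p. 403] -/
theorem setOf_realize_eq_image_of_finite (f : k ↪[Language.orderedExpRing] K) {κ : Type} {n : ℕ}
    (φ : Language.orderedRing.Formula (κ ⊕ Fin n)) (c : κ → k)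
    (hfin : {x : Fin n → K | φ.Realize (Sum.elim ((f : k → K) ∘ c) x)}.Finite) :
    {x : Fin n → K | φ.Realize (Sum.elim ((f : k → K) ∘ c) x)} =
      (fun y : Fin n → k => (f : k → K) ∘ y) '' {y : Fin n → k | φ.Realize (Sum.elim c y)} := by
  set SK := {x : Fin n → K | φ.Realize (Sum.elim ((f : k → K) ∘ c) x)} with hSK
  set Sk := {y : Fin n → k | φ.Realize (Sum.elim c y)} with hSk
  -- pointwise: `f ∘ y` is a solution iff `y` is
  have hpt : ∀ y : Fin n → k, ((f : k → K) ∘ y) ∈ SK ↔ y ∈ Sk := by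
    intro y
    simp only [hSK, hSk, Set.mem_setOf_eq]
    have : Sum.elim ((f : k → K) ∘ c) ((f : k → K) ∘ y) = (f : k → K) ∘ Sum.elim c y := by
      funext z; rcases z with z | z <;> rfl
    rw [this]
    exact realize_orderedRing_comp_iff f φ (Sum.elim c y)
  -- the counts agree
  set r := hfin.toFinset.card with hr
  have hK : SK.encard = r := hfin.encard_eq_coe_toFinset_card
  have hk : Sk.encard = r := by
    have h1 : (FOCount.exactCardF φ r).Realize ((f : k → K) ∘ c) :=
      (FOCount.realize_exactCardF φ r _).2 hK
    rw [realize_orderedRing_comp_iff f] at h1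
    exact (FOCount.realize_exactCardF φ r c).1 h1
  have hinj : Function.Injective fun y : Fin n → k => (f : k → K) ∘ y :=
    fun y y' h => funext fun i => f.injective (congrFun h i)
  have hsub : (fun y : Fin n → k => (f : k → K) ∘ y) '' Sk ⊆ SK := by
    rintro _ ⟨y, hy, rfl⟩; exact (hpt y).2 hy
  refine ((hfin.subset hsub).eq_of_subset_of_encard_le hsub ?_).symm
  rw [hinj.encard_image, hk, hK]

/-! ### Square polynomial systems over `k` -/

section Poly

variable {n : ℕ}

/-- A polynomial over `k` in `X₁, …, Xₙ`, with its coefficients turned into parameter variables: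
an integer polynomial in the variables `k ⊕ Fin n` realizing, at the assignment
`(c ↦ v c, j ↦ x j)`, to `Σ_d v(coeff_d) · x^d`. [folklore] -/
def liftPoly (P : MvPolynomial (Fin n) k) : MvPolynomial (k ⊕ Fin n) ℤ :=
  ∑ d ∈ P.support, MvPolynomial.X (Sum.inl (P.coeff d)) *
    ∏ j ∈ d.support, MvPolynomial.X (Sum.inr j) ^ d j

/-- Evaluation of `liftPoly`: with the coefficients sent along a ring homomorphism `g`, it is
`eval₂ g x P`. [folklore] -/
theorem aeval_liftPoly {R : Type*} [CommRing R] (g : k →+* R) (x : Fin n → R)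
    (P : MvPolynomial (Fin n) k) :
    MvPolynomial.aeval (Sum.elim (g : k → R) x) (liftPoly P) = MvPolynomial.eval₂ g x P := by
  rw [liftPoly, MvPolynomial.eval₂_eq, _root_.map_sum]
  refine Finset.sum_congr rfl fun d _ => ?_
  rw [_root_.map_mul, MvPolynomial.aeval_X, Sum.elim_inl, _root_.map_prod]
  congr 1
  refine Finset.prod_congr rfl fun j _ => ?_
  rw [_root_.map_pow, MvPolynomial.aeval_X, Sum.elim_inr]

/-- The Jacobian determinant `det (∂Pᵢ/∂Xⱼ)` of a square polynomial system, a polynomial.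
[folklore] -/
def jacobianPoly (P : Fin n → MvPolynomial (Fin n) k) : MvPolynomial (Fin n) k :=
  (Matrix.of fun i j => MvPolynomial.pderiv j (P i)).det

/-- Evaluating the Jacobian polynomial gives the Jacobian determinant of the values. [folklore] -/
theorem eval₂_jacobianPoly {R : Type*} [CommRing R] (g : k →+* R) (x : Fin n → R)
    (P : Fin n → MvPolynomial (Fin n) k) :
    MvPolynomial.eval₂ g x (jacobianPoly P) =
      (Matrix.of fun i j => MvPolynomial.eval₂ g x (MvPolynomial.pderiv j (P i))).det := by
  rw [jacobianPoly, show MvPolynomial.eval₂ g x = MvPolynomial.eval₂Hom g x from rfl,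
    RingHom.map_det]
  rfl

/-- The formula of ordered rings "`x̄` is a non-singular zero of `P₁, …, Pₙ`", the coefficients
being parameter variables indexed by `k` itself. [folklore] -/
def vnsPolyFormula (P : Fin n → MvPolynomial (Fin n) k) : Language.orderedRing.Formula (k ⊕ Fin n) :=
  (Formula.iInf fun i => (RCFQE.polyTerm (liftPoly (P i))).equal 0) ⊓
    ((RCFQE.polyTerm (liftPoly (jacobianPoly P))).equal 0).not

/-- Realization of `vnsPolyFormula` in an ordered commutative ring, coefficients sent along `g`.
[folklore] -/
theorem realize_vnsPolyFormula {R : Type*} [CommRing R] [LE R] (g : k →+* R)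
    (P : Fin n → MvPolynomial (Fin n) k) (x : Fin n → R) :
    (vnsPolyFormula P).Realize (Sum.elim (g : k → R) x) ↔
      (∀ i, MvPolynomial.eval₂ g x (P i) = 0) ∧
        (Matrix.of fun i j => MvPolynomial.eval₂ g x (MvPolynomial.pderiv j (P i))).det ≠ 0 := by
  simp only [vnsPolyFormula, Formula.realize_inf, Formula.realize_iInf, Formula.realize_not,
    Formula.realize_equal, RCFQE.realize_polyTerm, aeval_liftPoly, eval₂_jacobianPoly,
    Language.orderedRing.realize_zero, ne_eq]

/-- **`P_{0,s}` (Wilkie 1989, p. 403): non-singular zeros of polynomial systems over `k` lie in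
`kⁿ`.**  Let `k ⊆ K` be models of `T_exp` (embedding `f`) and `P₁, …, Pₙ ∈ k[X₁, …, Xₙ]`. If the
set of non-singular zeros of `P̄` in `Kⁿ` is finite, then each of them is the image of a point of
`kⁿ` ("it is well known that the coordinates of an `ᾱ ∈ Vⁿˢ(g₁, …, gₙ)`, where `gᵢ ∈ k[x̄]`, are
algebraic over `k`, and `k, K` are real-closed fields"; here via Tarski's theorem: `k ≼ K` for
formulas of ordered rings). [cite: Wilkie1989, §6, p. 403] -/
theorem exists_eq_of_nonsingular_mvPolynomial (f : k ↪[Language.orderedExpRing] K)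
    (P : Fin n → MvPolynomial (Fin n) k) {α : Fin n → K}
    (hzero : ∀ i, MvPolynomial.eval₂ (toRingHom f) α (P i) = 0)
    (hdet : (Matrix.of fun i j =>
      MvPolynomial.eval₂ (toRingHom f) α (MvPolynomial.pderiv j (P i))).det ≠ 0)
    (hfin : {x : Fin n → K | (∀ i, MvPolynomial.eval₂ (toRingHom f) x (P i) = 0) ∧
      (Matrix.of fun i j =>
        MvPolynomial.eval₂ (toRingHom f) x (MvPolynomial.pderiv j (P i))).det ≠ 0}.Finite) :
    ∃ β : Fin n → k, (f : k → K) ∘ β = α := by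
  have hset : {x : Fin n → K | (vnsPolyFormula P).Realize (Sum.elim ((f : k → K) ∘ _root_.id) x)} =
      {x : Fin n → K | (∀ i, MvPolynomial.eval₂ (toRingHom f) x (P i) = 0) ∧
        (Matrix.of fun i j =>
          MvPolynomial.eval₂ (toRingHom f) x (MvPolynomial.pderiv j (P i))).det ≠ 0} := by
    ext x
    rw [Set.mem_setOf_eq, Set.mem_setOf_eq, Function.comp_id, ← coe_toRingHom f,
      realize_vnsPolyFormula]
  have hfin' : {x : Fin n → K |
      (vnsPolyFormula P).Realize (Sum.elim ((f : k → K) ∘ _root_.id) x)}.Finite := by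
    rw [hset]; exact hfin
  have heq := setOf_realize_eq_image_of_finite f (vnsPolyFormula P) _root_.id hfin'
  have hα : α ∈ {x : Fin n → K |
      (vnsPolyFormula P).Realize (Sum.elim ((f : k → K) ∘ _root_.id) x)} := by
    rw [hset]; exact ⟨hzero, hdet⟩
  rw [heq] at hα
  obtain ⟨β, -, hβ⟩ := hα
  exact ⟨β, hβ⟩

end Poly

/-! ### The polynomial stages of the chain: height `0` in the tree's set-up -/

section Chain

variable (f : k ↪[Language.orderedExpRing] K) (n : ℕ)

/-- **Polynomials over `k` as term functions**: the ring homomorphism `k[X₁, …, Xₙ] → k[x̄]ᵉ`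
sending constants to constant functions and `Xᵢ` to the coordinate function `xᵢ`. [folklore] -/
def polyFn : MvPolynomial (Fin n) k →+* termFnRing f n :=
  MvPolynomial.eval₂Hom (constHom f n) (coordFn f n)

variable {f n}

/-- Unfolding of `polyFn`. [folklore] -/
theorem polyFn_apply (P : MvPolynomial (Fin n) k) :
    polyFn f n P = MvPolynomial.eval₂ (constHom f n) (coordFn f n) P := rfl

/-- Values of polynomial term functions. [folklore] -/
@[simp] theorem coe_polyFn (P : MvPolynomial (Fin n) k) (x : Fin n → K) :
    ((polyFn f n P : termFnRing f n) : (Fin n → K) → K) x =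
      MvPolynomial.eval₂ (toRingHom f) x P := by
  rw [← evalAt_apply f n x]
  rw [polyFn, ← RingHom.comp_apply, MvPolynomial.comp_eval₂Hom]
  have h1 : (evalAt f n x).comp (constHom f n) = toRingHom f := by
    ext c; simp
  have h2 : (fun i => evalAt f n x (coordFn f n i)) = x := by
    funext i; simp
  rw [h1, h2]
  rfl

/-- **`∂/∂xₗ` of a polynomial term function is the polynomial partial derivative** (Wilkie's
derivations on `k[x̄]` are the usual ones, p. 385). [cite: Wilkie1989, §1, p. 385] -/
theorem pd_polyFn (l : Fin n) (P : MvPolynomial (Fin n) k) :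
    pd f n l (polyFn f n P) = polyFn f n (MvPolynomial.pderiv l P) := by
  induction P using MvPolynomial.induction_on with
  | C c =>
    rw [MvPolynomial.pderiv_C, _root_.map_zero, polyFn_apply, MvPolynomial.eval₂_C,
      constHom_apply, pd_constFn]
  | add p q hp hq =>
    rw [_root_.map_add, pd_add, hp, hq, _root_.map_add, _root_.map_add]
  | mul_X p j hp =>
    have hX : polyFn f n (MvPolynomial.X j) = coordFn f n j := by
      rw [polyFn_apply, MvPolynomial.eval₂_X]
    rw [_root_.map_mul, pd_mul, hp, hX, pd_coordFn, (MvPolynomial.pderiv l).leibniz,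
      MvPolynomial.pderiv_X, smul_eq_mul, smul_eq_mul, _root_.map_add, _root_.map_mul,
      _root_.map_mul, hX]
    by_cases hjl : j = l
    · subst hjl
      rw [Pi.single_eq_same, if_pos rfl, _root_.map_one, mul_one, add_comm,
        mul_comm (coordFn f n j)]
    · rw [Pi.single_eq_of_ne hjl, if_neg hjl, _root_.map_zero, mul_zero, add_zero,
        zero_add, mul_comm (coordFn f n j)]

/-- **The polynomial stages `M_m = k[x₁, …, xₘ]` (`m ≤ n`) consist of polynomial functions.**
[cite: Wilkie1989, §3, p. 391] -/
theorem chain_le_range_polyFn (g : ℕ → termFnRing f n) {m : ℕ} (hm : m ≤ n) :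
    chain f n g m ≤ (polyFn f n).range := by
  induction m with
  | zero =>
    intro F hF
    obtain ⟨c, rfl⟩ := (mem_chain_zero f n g).1 hF
    refine ⟨MvPolynomial.C c, ?_⟩
    show MvPolynomial.eval₂ (constHom f n) (coordFn f n) (MvPolynomial.C c) = _
    rw [MvPolynomial.eval₂_C, constHom_apply]
  | succ m ih =>
    intro F hF
    obtain ⟨Q, rfl⟩ := (mem_chain_succ f n g).1 hF
    have hmn : m < n := Nat.lt_of_succ_le hm
    rw [chainGen_of_lt f n g hmn, Polynomial.eval_eq_sum, Polynomial.sum_def]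
    refine Subring.sum_mem _ fun e _ => Subring.mul_mem _ ?_ (Subring.pow_mem _ ?_ _)
    · rw [Polynomial.coeff_map]
      exact ih hmn.le (Q.coeff e).2
    · refine ⟨MvPolynomial.X ⟨m, hmn⟩, ?_⟩
      show MvPolynomial.eval₂ (constHom f n) (coordFn f n) (MvPolynomial.X _) = _
      rw [MvPolynomial.eval₂_X]

/-- **The height-`0` case of `P_{j,s}` in chain form** (Wilkie 1989, p. 403, "`P_{0,s}` is clear"):
if `h₁, …, hₙ` lie in a polynomial stage `M_m` (`m ≤ n`) of an admissible chain, `ᾱ ∈ Vⁿˢ(h̄)`, and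
`Vⁿˢ(h̄) ⊆ Kⁿ` is finite (in §6: Khovanskii's bound, transferred), then `ᾱ ∈ kⁿ`. [cite: Wilkie1989, §6, p. 403] -/
theorem exists_eq_of_vnsF_chain_le {g : ℕ → termFnRing f n} {m : ℕ} (hm : m ≤ n)
    {F : Fin n → termFnRing f n} (hF : ∀ r, F r ∈ chain f n g m) {α : Fin n → K}
    (hα : α ∈ VnsF f n F) (hfin : (VnsF f n F).Finite) : ∃ β : Fin n → k, (f : k → K) ∘ β = α := by
  -- the system is polynomial
  have hpoly : ∀ r, ∃ P : MvPolynomial (Fin n) k, polyFn f n P = F r := fun r =>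
    chain_le_range_polyFn g hm (hF r)
  choose P hP using hpoly
  -- the non-singular zero set of `F` is that of `P̄`
  have hVns : VnsF f n F = {x : Fin n → K | (∀ i, MvPolynomial.eval₂ (toRingHom f) x (P i) = 0) ∧
      (Matrix.of fun i j =>
        MvPolynomial.eval₂ (toRingHom f) x (MvPolynomial.pderiv j (P i))).det ≠ 0} := by
    ext x
    simp only [VnsF, Set.mem_setOf_eq, mem_VF]
    refine and_congr (forall_congr' fun r => ?_) ?_
    · rw [← hP r, coe_polyFn]
    · have hA : (fun r => jrow f n (F r) x) = fun i => (Matrix.of fun i j =>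
          MvPolynomial.eval₂ (toRingHom f) x (MvPolynomial.pderiv j (P i))) i := by
        funext i j
        simp only [Matrix.of_apply, jrow]
        rw [← hP i, pd_polyFn, coe_polyFn]
      rw [hA, linearIndependent_rows_iff_det_ne_zero]
  have hα' := hα
  rw [hVns] at hα' hfin
  exact exists_eq_of_nonsingular_mvPolynomial f P hα'.1 hα'.2 hfin

end Chain

end RealExpModel

end Literature.ModelTheory.ExponentialFields
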